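import Mathlib.Analysis.Convex.Star
import Mathlib.Analysis.Convex.PathConnected
import Literature.Probability.RandomPlanarGeometry.RestrictionHulls
import HarnessLib

/-!
# Two-sided restriction measures (Lawler–Schramm–Werner 2003, §3): the space `Ω` and `P_α`

Level 2 of the decomposition of the named fact `Literature.Probability.RandomPlanarGeometry.LawlerSchrammWerner2003` (files
`ConformalRestriction`, `ConformalRestrictionProofs`, `RestrictionHulls`): the measure-theoretic
vocabulary of

* G. F. Lawler, O. Schramm, W. Werner, *Conformal restriction: the chordal case*, J. Amer. Math.
  Soc. **16** (2003) 917–955, arXiv:math/0209343 (**[LSW]**, arXiv page numbers), §3,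

and the results of the paper that are PRINTED in it, as named facts:

* `Literature.Probability.RandomPlanarGeometry.restrictionConfigs` / `Literature.Probability.RandomPlanarGeometry.RestrictionConfig` — [LSW] Def. 3.1 (p. 10): the collection
  `Ω` of relatively closed subsets `K` of the OPEN half-plane `ℍ` with `K` connected,
  `cl(K) ∩ ℝ = {0}`, `K` unbounded and `ℂ ∖ cl(K)` connected, with "the σ-field generated by the
  events `{K ∈ Ω : K ∩ A = ∅}`, `A ∈ 𝒬*`" (`RestrictionConfig.instMeasurableSpace`,
  `RestrictionConfig.avoid A`);
* `Literature.Probability.RandomPlanarGeometry.RestrictionConfig.ext_of_avoid` — NAMED FACT, [LSW] Lemma 3.2 (p. 10): two probability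
  measures on `Ω` agreeing on all events `{K ∩ A = ∅}`, `A ∈ 𝒬*`, are equal; PROVED
  (`ext_of_avoid_of_isPiSystem`, Dynkin) from the named fact `RestrictionConfig.isPiSystem_avoid`
  (ibid.: "this family of events is closed under finite intersection", the filling of `A ∪ A'`);
* `Literature.IsRestrictionMeasure α P` — [LSW] Prop. 3.3 (3) / Def. 3.4 (pp. 10–11): `P` is a
  probability measure on `Ω` with `P[K ∩ A = ∅] = Φ'_A(0)^α` for all `A ∈ 𝒬*` ("the two-sided
  restriction measure with exponent `α`", `P_α`); `IsRestrictionMeasure.unique` ("for each `α > 0`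
  there exists at most one `P_α`", Prop. 3.3, last sentence) is PROVED from Lemma 3.2;
* `Literature.Probability.RandomPlanarGeometry.RestrictionConfig.IsHullProduct`, `IsScaleInvariant`, `IsHullMultiplicative` — the
  semigroup product `A · A'` of `𝒬*` (§2 p. 8: `Φ_{A·A'} = Φ_A ∘ Φ_{A'}`) and hypothesis (1) of
  Prop. 3.3, "`P` is `Γ`-invariant and `𝒜₁`-covariant", in the form in which the proof of the
  proposition uses it: the function `F(A) = P[K ∩ A = ∅]` on `𝒬*` is invariant under dilations and
  is a semigroup homomorphism (§2 p. 9: "`F_{φ∘ψ} = F_φ F_ψ`");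
  `Literature.Probability.RandomPlanarGeometry.exists_isRestrictionMeasure_of_isHullMultiplicative` — NAMED FACT, [LSW] Prop. 3.3
  (1) ⇒ (3): such a `P` is `P_α` for some `α > 0`;
* `Literature.Probability.RandomPlanarGeometry.exists_isRestrictionMeasure_iff` — NAMED FACT, [LSW] p. 5 result 1 (Thm. 7.3 p. 29 with
  §4, and Cor. 8.6 p. 37): for `α > 0`, "the restriction measure `P_α` exists if and only if
  `α ≥ 5/8`";
* `Literature.Probability.RandomPlanarGeometry.IsRestrictionMeasure.eq_five_eighths_of_simple` — NAMED FACT, [LSW] p. 5 result 2, first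
  sentence (Thm. 7.3, Cor. 8.6, [42]): "The only measure `P_α` that is supported on simple curves
  is `P_{5/8}`" (`RestrictionConfig.IsSimplePath`: `K = γ(0, ∞)` for a simple path `γ` from `0`
  to `∞` in the upper half-plane), in the `∀ᵐ` reading; and
  `Literature.Probability.RandomPlanarGeometry.IsRestrictionMeasure.eq_five_eighths_of_outer_simple` — NAMED FACT, the same sentence with
  "supported on" read as an outer-measure condition (every measurable event containing the simple
  curves is almost sure), the form usable for image laws, which implies the `∀ᵐ` reading
  (`eq_five_eighths_of_simple_of_outer`, proved).

Proved API: the open imaginary half-axis `{i t : t > 0}` is a configuration (`Ω ≠ ∅`,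
`RestrictionConfig.imaginaryAxis`; it is a simple path), the generating events are measurable,
`A · ∅ = A`, uniqueness of `P_α`.

Not vendored (level 3): the image maps `K ↦ Φ_A(K)`, `K ↦ λK` on `Ω` and the equivalence of the
homomorphism form of (1) with the paper's measure form (which is Lemma 3.2 applied to the
conditional laws), (2) ⇔ (3) ⇔ (4) of Prop. 3.3, the Hausdorff-metric description of the σ-field,
§4 (Brownian excursions, `P_1`), §7 (bubbles), §8 (one-sided restriction, SLE(κ, ρ)).
-/

noncomputable section

open Set Filter Topology MeasureTheory
open UpperHalfPlane (upperHalfPlaneSet)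
open scoped NNReal ENNReal Pointwise

namespace Literature.Probability.RandomPlanarGeometry

/-! ### The space `Ω` ([LSW] Def. 3.1) -/

/-- **[LSW] Definition 3.1** (p. 10): "Let `Ω` be the collection of relatively closed subsets `K`
of `ℍ` such that (1) `K` is connected, `cl(K) ∩ ℝ = {0}` and `K` is unbounded; (2) `ℂ ∖ cl(K)`
is connected." Here `ℍ = ℍₒ` is the OPEN upper half-plane, "relatively closed" is
`cl(K) ∩ ℍₒ = K` (which contains `K ⊆ ℍₒ`), and `cl` is the closure in `ℂ`. "A simple example of
a set `K ∈ Ω` is a simple curve `γ` from `0` to infinity in the upper half-plane."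
[cite: LawlerSchrammWerner2003Restriction, Def. 3.1 (p. 10)] -/
def restrictionConfigs : Set (Set ℂ) :=
  {K | closure K ∩ upperHalfPlaneSet = K ∧ IsConnected K ∧
    closure K ∩ range ((↑) : ℝ → ℂ) = {0} ∧ ¬ Bornology.IsBounded K ∧ IsConnected (closure K)ᶜ}

/-- The type of configurations `K ∈ Ω` ([LSW] Def. 3.1), on which the restriction measures live.
[cite: LawlerSchrammWerner2003Restriction, Def. 3.1 (p. 10)] -/
def RestrictionConfig : Type := {K : Set ℂ // K ∈ restrictionConfigs}

namespace RestrictionConfig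

/-- The underlying set of a configuration. [folklore] -/
instance instCoe : CoeOut RestrictionConfig (Set ℂ) := ⟨Subtype.val⟩

/-- A configuration is a subset of the open upper half-plane. [folklore] -/
theorem subset_upperHalfPlaneSet (K : RestrictionConfig) : (K : Set ℂ) ⊆ upperHalfPlaneSet := by
  rw [← K.2.1]
  exact inter_subset_right

/-- A configuration is relatively closed in the open upper half-plane. [folklore] -/
theorem closure_inter_eq (K : RestrictionConfig) : closure (K : Set ℂ) ∩ upperHalfPlaneSet = K :=
  K.2.1

/-- A configuration is connected. [folklore] -/
theorem isConnected (K : RestrictionConfig) : IsConnected (K : Set ℂ) :=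
  K.2.2.1

/-- The closure of a configuration meets the real axis exactly at the origin. [folklore] -/
theorem closure_inter_range_ofReal (K : RestrictionConfig) :
    closure (K : Set ℂ) ∩ range ((↑) : ℝ → ℂ) = {0} :=
  K.2.2.2.1

/-- The origin does not belong to a configuration (it lies on the real axis, the configuration
in the open half-plane), although it belongs to its closure. [folklore] -/
theorem zero_notMem (K : RestrictionConfig) : (0 : ℂ) ∉ (K : Set ℂ) := fun h ↦ by
  have := K.subset_upperHalfPlaneSet h
  simp [upperHalfPlaneSet] at this

/-- The event "`K` avoids `A`", `{K ∈ Ω : K ∩ A = ∅}` ([LSW] §3 p. 10). [cite: LawlerSchrammWerner2003Restriction, §3 p. 10] -/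
def avoid (A : Set ℂ) : Set RestrictionConfig := {K | Disjoint (K : Set ℂ) A}

/-- Membership in the avoidance event. [folklore] -/
@[simp] theorem mem_avoid {A : Set ℂ} {K : RestrictionConfig} :
    K ∈ avoid A ↔ Disjoint (K : Set ℂ) A := Iff.rfl

/-- **The σ-field on `Ω`** ([LSW] §3 p. 10): "We endow `Ω` with the σ-field generated by the
events `{K ∈ Ω : K ∩ A = ∅}`, where `A ∈ 𝒬*`." (It coincides with the Borel σ-field of the
Hausdorff metric on closed subsets of `ℍ̄ ∪ {∞}`, ibid.; not used here.)
[cite: LawlerSchrammWerner2003Restriction, §3 p. 10] -/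
instance instMeasurableSpace : MeasurableSpace RestrictionConfig :=
  MeasurableSpace.generateFrom {S | ∃ A, IsStarHull A ∧ S = avoid A}

/-- The generating events are measurable. [folklore] -/
theorem measurableSet_avoid {A : Set ℂ} (hA : IsStarHull A) : MeasurableSet (avoid A) :=
  MeasurableSpace.measurableSet_generateFrom ⟨A, hA, rfl⟩

/-- Every configuration avoids the empty hull. [folklore] -/
@[simp] theorem avoid_empty : avoid (∅ : Set ℂ) = univ := by
  ext K
  simp

/-- Avoiding a union is avoiding both parts ("this family of events is closed under finite
intersection", [LSW] §3 p. 10 — modulo replacing `A ∪ A'` by its filling). [folklore] -/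
theorem avoid_union (A A' : Set ℂ) : avoid (A ∪ A') = avoid A ∩ avoid A' := by
  ext K
  simp [disjoint_union_right]

/-- The imaginary axis `t ↦ i t` is an isometry `ℝ → ℂ`. [folklore] -/
theorem isometry_mul_I : Isometry fun t : ℝ ↦ (Complex.I * t : ℂ) :=
  Isometry.of_dist_eq fun s t ↦ by
    rw [dist_eq_norm, dist_eq_norm, ← mul_sub, norm_mul, Complex.norm_I, one_mul,
      ← Complex.ofReal_sub, Complex.norm_real]

/-- The closure of the open imaginary half-axis is the closed one. [folklore] -/
theorem closure_imaginaryAxis :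
    closure ((fun t : ℝ ↦ (Complex.I * t : ℂ)) '' Ioi 0) =
      (fun t : ℝ ↦ (Complex.I * t : ℂ)) '' Ici 0 := by
  rw [isometry_mul_I.isClosedEmbedding.closure_image_eq, closure_Ioi]

/-- The closed imaginary half-axis in coordinates. [folklore] -/
theorem image_mul_I_Ici :
    (fun t : ℝ ↦ (Complex.I * t : ℂ)) '' Ici 0 = {z : ℂ | z.re = 0 ∧ 0 ≤ z.im} := by
  ext z
  constructor
  · rintro ⟨t, ht, rfl⟩
    exact ⟨by simp, by simpa using ht⟩
  · rintro ⟨h1, h2⟩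
    exact ⟨z.im, h2, Complex.ext (by simp [h1]) (by simp)⟩

/-- The open imaginary half-axis in coordinates. [folklore] -/
theorem image_mul_I_Ioi :
    (fun t : ℝ ↦ (Complex.I * t : ℂ)) '' Ioi 0 = {z : ℂ | z.re = 0 ∧ 0 < z.im} := by
  ext z
  constructor
  · rintro ⟨t, ht, rfl⟩
    exact ⟨by simp, by simpa using ht⟩
  · rintro ⟨h1, h2⟩
    exact ⟨z.im, h2, Complex.ext (by simp [h1]) (by simp)⟩

/-- The **imaginary half-axis** `{i t : t > 0}`, the simplest configuration ("a simple curve from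
`0` to infinity in the upper half-plane", [LSW] after Def. 3.1): relatively closed in `ℍₒ`,
connected, its closure `{i t : t ≥ 0}` meets `ℝ` only at `0`, unbounded, and the complement of
its closure is connected (indeed star-shaped about `−i`). Non-vacuity of `Ω`. [folklore] -/
def imaginaryAxis : RestrictionConfig :=
  ⟨(fun t : ℝ ↦ (Complex.I * t : ℂ)) '' Ioi 0, by
    refine ⟨?_, ?_, ?_, ?_, ?_⟩
    · -- relatively closed in the open half-plane
      rw [closure_imaginaryAxis, image_mul_I_Ici, image_mul_I_Ioi]
      ext z
      simp only [mem_inter_iff, mem_setOf_eq, upperHalfPlaneSet]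
      constructor
      · rintro ⟨⟨h1, -⟩, h2⟩
        exact ⟨h1, h2⟩
      · rintro ⟨h1, h2⟩
        exact ⟨⟨h1, h2.le⟩, h2⟩
    · -- connected
      exact (isConnected_Ioi (a := (0 : ℝ))).image _ isometry_mul_I.continuous.continuousOn
    · -- the closure meets `ℝ` exactly at `0`
      rw [closure_imaginaryAxis]
      ext z
      simp only [mem_inter_iff, mem_image, mem_Ici, mem_range, mem_singleton_iff]
      constructor
      · rintro ⟨⟨t, -, rfl⟩, ⟨x, hx⟩⟩
        have := congrArg Complex.im hx
        simp only [Complex.ofReal_im, Complex.mul_im, Complex.I_re, Complex.ofReal_im, mul_zero,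
          Complex.I_im, Complex.ofReal_re, one_mul, zero_add] at this
        simp [← this]
      · rintro rfl
        exact ⟨⟨0, le_rfl, by simp⟩, ⟨0, by simp⟩⟩
    · -- unbounded
      intro hb
      obtain ⟨C, hC⟩ := hb.subset_closedBall 0
      have hmem : (Complex.I * ((|C| + 1 : ℝ) : ℂ)) ∈ (fun t : ℝ ↦ (Complex.I * t : ℂ)) '' Ioi 0 :=
        ⟨|C| + 1, mem_Ioi.2 (by positivity), rfl⟩
      have h := hC hmem
      rw [Metric.mem_closedBall, dist_zero_right, norm_mul, Complex.norm_I, one_mul,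
        Complex.norm_real, Real.norm_eq_abs, abs_of_pos (by positivity)] at h
      linarith [le_abs_self C]
    · -- the complement of the closure is star-shaped about `-i`, hence connected
      rw [closure_imaginaryAxis]
      have hstar : StarConvex ℝ (-Complex.I) ((fun t : ℝ ↦ (Complex.I * t : ℂ)) '' Ici 0)ᶜ := by
        intro z hz a b ha hb hab
        rintro ⟨t, ht, h⟩
        have ht' : (0 : ℝ) ≤ t := mem_Ici.1 ht
        have hre := congrArg Complex.re h
        have him := congrArg Complex.im h
        simp only [Complex.mul_re, Complex.I_re, Complex.ofReal_re, zero_mul, Complex.I_im,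
          Complex.ofReal_im, mul_zero, sub_zero, Complex.add_re, Complex.smul_re, Complex.neg_re,
          smul_eq_mul, Complex.mul_im, one_mul, zero_add, Complex.add_im, Complex.smul_im,
          Complex.neg_im] at hre him
        rcases eq_or_ne b 0 with rfl | hb0
        · simp only [zero_mul, add_zero] at him
          have : a = 1 := by linarith
          subst this
          linarith
        · have hzre : z.re = 0 := by
            have : b * z.re = 0 := by linarith
            exact (mul_eq_zero.1 this).resolve_left hb0
          have hb' : 0 < b := lt_of_le_of_ne hb hb0.symm
          have hzim : z.im < 0 := by
            by_contra hcon
            exact hz ⟨z.im, not_lt.1 hcon, Complex.ext (by simp [hzre]) (by simp)⟩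
          nlinarith
      have hmem : -Complex.I ∈ ((fun t : ℝ ↦ (Complex.I * t : ℂ)) '' Ici 0)ᶜ := by
        rintro ⟨t, ht, h⟩
        have ht' : (0 : ℝ) ≤ t := mem_Ici.1 ht
        have := congrArg Complex.im h
        simp at this
        linarith
      exact (hstar.isPathConnected hmem).isConnected⟩

/-- `Ω` is nonempty. [folklore] -/
instance instNonempty : Nonempty RestrictionConfig := ⟨imaginaryAxis⟩

/-- **"`K` is a simple curve"** for a configuration: `K = γ(0, ∞)` for a continuous injective
path `γ : [0, ∞) → ℂ` with `γ(0) = 0` and `|γ(t)| → ∞` ([LSW] after Def. 3.1: "a simple curve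
`γ` from `0` to infinity in the upper half-plane"; p. 5 result 2: "supported on simple curves";
Thm. 6.1: "the law of `γ(0, ∞)`"). Since `K ⊆ ℍₒ`, `γ(0, ∞) ⊆ ℍₒ` is automatic.
[cite: LawlerSchrammWerner2003Restriction, Def. 3.1 (p. 10) and p. 5 result 2] -/
def IsSimplePath (K : RestrictionConfig) : Prop :=
  ∃ γ : ℝ≥0 → ℂ, Continuous γ ∧ Function.Injective γ ∧ γ 0 = 0 ∧
    Tendsto (fun t ↦ ‖γ t‖) atTop atTop ∧ (K : Set ℂ) = γ '' Ioi 0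

/-- The imaginary half-axis is a simple curve from `0` to `∞` (`γ(t) = i t`). [folklore] -/
theorem isSimplePath_imaginaryAxis : imaginaryAxis.IsSimplePath := by
  refine ⟨fun t ↦ Complex.I * (t : ℝ), by fun_prop, ?_, by simp, ?_, ?_⟩
  · intro s t h
    have := congrArg Complex.im h
    simp only [Complex.mul_im, Complex.I_re, Complex.ofReal_im, mul_zero, Complex.I_im,
      Complex.ofReal_re, one_mul, zero_add] at this
    exact_mod_cast this
  · have h : (fun t : ℝ≥0 ↦ ‖(Complex.I * (t : ℝ) : ℂ)‖) = fun t : ℝ≥0 ↦ (t : ℝ) := by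
      ext t
      rw [norm_mul, Complex.norm_I, one_mul, Complex.norm_real, Real.norm_eq_abs]
      exact abs_of_nonneg t.2
    rw [h]
    exact NNReal.tendsto_coe_atTop.2 tendsto_id
  · show (fun t : ℝ ↦ (Complex.I * t : ℂ)) '' Ioi 0 = _
    ext z
    simp only [mem_image, mem_Ioi]
    constructor
    · rintro ⟨t, ht, rfl⟩
      exact ⟨⟨t, ht.le⟩, by exact_mod_cast ht, rfl⟩
    · rintro ⟨t, ht, rfl⟩
      exact ⟨t, by exact_mod_cast ht, rfl⟩

/-- NAMED FACT — **[LSW] Lemma 3.2** (p. 10): "Let `P` and `P'` be two probability measures on `Ω`.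
If `P[K ∩ A = ∅] = P'[K ∩ A = ∅]` holds for every `A ∈ 𝒬*`, then `P = P'`." (The events
`{K ∩ A = ∅}` generate the σ-field and are closed under finite NONEMPTY intersections — the
filling of `A ∪ A'` is again in `𝒬*` unless it swallows `0`, in which case the intersection is
empty — so this is Dynkin's π-λ theorem.) [cite: LawlerSchrammWerner2003Restriction, Lemma 3.2 (p. 10)] -/
def ext_of_avoid : Prop :=
  ∀ (P P' : Measure RestrictionConfig), IsProbabilityMeasure P → IsProbabilityMeasure P' →
    (∀ A, IsStarHull A → P (avoid A) = P' (avoid A)) → P = P'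

/-- NAMED FACT — **the generating events form a π-system** ([LSW] §3 p. 10: "It is easy to check
that this family of events is closed under finite intersection"): for `A, A' ∈ 𝒬*`,
`{K ∩ A = ∅} ∩ {K ∩ A' = ∅} = {K ∩ (A ∪ A') = ∅}` is again a generating event `{K ∩ B = ∅}`,
`B ∈ 𝒬*` the hull obtained by filling in `A ∪ A'` (a connected unbounded `K` avoiding `A ∪ A'`
lies in the unbounded component of `ℍₒ ∖ (A ∪ A')`) — unless the filling swallows `0`, in which
case the intersection is empty (every `K ∈ Ω` is connected, unbounded and has `0` in its
closure); Mathlib's `IsPiSystem` asks closure under NONEMPTY intersections only.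
[cite: LawlerSchrammWerner2003Restriction, §3 p. 10 (before Lemma 3.2)] -/
def isPiSystem_avoid : Prop :=
  IsPiSystem {S : Set RestrictionConfig | ∃ A, IsStarHull A ∧ S = avoid A}

/-- **Lemma 3.2 from the π-system property** (Dynkin's π-λ theorem, Mathlib's
`MeasureTheory.ext_of_generate_finite`): this is the paper's one-line proof "so that a
probability measure on `Ω` is characterized by the values of `P[K ∩ A = ∅]` for `A ∈ 𝒬*`".
[cite: LawlerSchrammWerner2003Restriction, Lemma 3.2 (p. 10)] -/
theorem ext_of_avoid_of_isPiSystem (h : isPiSystem_avoid) : ext_of_avoid := by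
  intro P P' hP hP' hA
  refine MeasureTheory.ext_of_generate_finite _ rfl h ?_ (by rw [measure_univ, measure_univ])
  rintro _ ⟨A, hA', rfl⟩
  exact hA A hA'

/-! ### The semigroup `𝒬*` and hypothesis (1) of Prop. 3.3, in homomorphism form -/

/-- **The semigroup product of `*`-hulls** ([LSW] §2 p. 8: "We can consider `𝒬*` as a semigroup
with the product `·`, where `A · A'` is defined by `Φ_{A·A'} = Φ_A ∘ Φ_{A'}`"): `B = A · A'` iff
`B ∈ 𝒬*` and `ℍₒ ∖ B = Φ_{A'}⁻¹(ℍₒ ∖ A)`, the domain of `Φ_A ∘ Φ_{A'}`, for a restriction map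
`Φ_{A'}` of `A'` (any two agree on `ℍₒ ∖ A'`). Thus `K ∩ (A · A') = ∅` iff `K ∩ A' = ∅` and
`Φ_{A'}(K) ∩ A = ∅`. [cite: LawlerSchrammWerner2003Restriction, §2 p. 8 (semigroups)] -/
def IsHullProduct (A A' B : Set ℂ) : Prop :=
  IsStarHull B ∧ ∃ Φ' : ConformalEquiv (upperHalfPlaneSet \ A') upperHalfPlaneSet,
    IsRestrictionMap A' Φ' ∧
      upperHalfPlaneSet \ B = {z | z ∈ upperHalfPlaneSet \ A' ∧ Φ' z ∉ A}

/-- `A · ∅ = A` (`Φ_∅ = id`; non-vacuity of the product). [folklore] -/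
theorem isHullProduct_empty {A : Set ℂ} (hA : IsStarHull A) : IsHullProduct A ∅ A := by
  refine ⟨hA, restrictionMapEmpty, isRestrictionMap_empty, ?_⟩
  ext z
  simp

/-- **`Γ`-invariance, homomorphism form** ([LSW] Prop. 3.3 (1) with §2 p. 9: `Γ` the dilations
`z ↦ λz`, `λ > 0`; a `Γ`-invariant law has `F(λA) = P[K ∩ λA = ∅] = P[λ⁻¹K ∩ A = ∅] = F(A)`):
the avoidance probabilities are invariant under dilations of the hull.
[cite: LawlerSchrammWerner2003Restriction, Prop. 3.3 (1) (p. 10) with §2 p. 9 (Γ-invariant)] -/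
def IsScaleInvariant (P : Measure RestrictionConfig) : Prop :=
  ∀ A : Set ℂ, IsStarHull A → ∀ r : ℝ, 0 < r → P (avoid (r • A)) = P (avoid A)

/-- **`𝒜₁`-covariance, homomorphism form** ([LSW] Prop. 3.3 (1) with §2 p. 9: "if `μ` is
covariant under `Γ` then `F_{φ∘ψ} = F_φ F_ψ` … the mapping `F : φ ↦ F_φ` is a semigroup
homomorphism"; proof of Prop. 3.3, p. 11: "Define the homomorphism `F` of `𝒬*` onto the
multiplicative semigroup `(0, 1]` by `F(A) = P[K ∩ A = ∅]`"): `F(A · A') = F(A) F(A')`. The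
paper's `𝒜₁`-covariance (the law of `Φ_A(K)` on `{K ∩ A = ∅}` is `F(A) · P`) gives this on the
generating events; conversely the two finite measures "law of `Φ_A(K)` on `{K ∩ A = ∅}`" and
`F(A) · P` agree on all generating events by this identity, hence are equal by Lemma 3.2.
[cite: LawlerSchrammWerner2003Restriction, Prop. 3.3 (1) (p. 10) with §2 p. 9 (F homomorphism)] -/
def IsHullMultiplicative (P : Measure RestrictionConfig) : Prop :=
  ∀ A A' B : Set ℂ, IsStarHull A → IsStarHull A' → IsHullProduct A A' B →
    P (avoid B) = P (avoid A) * P (avoid A')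

end RestrictionConfig

/-! ### Restriction measures `P_α` ([LSW] Prop. 3.3 (3), Def. 3.4) -/

/-- **Two-sided restriction measure with exponent `α`** ([LSW] Def. 3.4 with Prop. 3.3 (3),
pp. 10–11): a probability measure `P` on `Ω` such that for every `A ∈ 𝒬*`,
`P[K ∩ A = ∅] = Φ'_A(0)^α` — here for every restriction map `Φ` of `A` and every `d` with
`HasRestrictionDeriv A Φ d` (i.e. `d = Φ'_A(0)`, unique, in `(0, 1]`). By Prop. 3.3 this is
equivalent to `P` being dilation-invariant and `𝒜₁`-covariant, or `𝒜`-covariant.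
[cite: LawlerSchrammWerner2003Restriction, Def. 3.4 with Prop. 3.3 (3) (pp. 10–11)] -/
def IsRestrictionMeasure (α : ℝ) (P : Measure RestrictionConfig) : Prop :=
  IsProbabilityMeasure P ∧
    ∀ {A : Set ℂ}, IsStarHull A →
      ∀ {Φ : ConformalEquiv (upperHalfPlaneSet \ A) upperHalfPlaneSet}, IsRestrictionMap A Φ →
        ∀ {d : ℝ}, HasRestrictionDeriv A Φ d → P (RestrictionConfig.avoid A) = ENNReal.ofReal (d ^ α)

/-- A restriction measure is a probability measure. [folklore] -/
theorem IsRestrictionMeasure.isProbabilityMeasure {α : ℝ} {P : Measure RestrictionConfig}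
    (h : IsRestrictionMeasure α P) : IsProbabilityMeasure P :=
  h.1

/-- **Uniqueness of `P_α`** ([LSW] Prop. 3.3, last sentence: "for each fixed `α > 0`, there exists
at most one probability measure `P_α` satisfying these conditions"), from Lemma 3.2 (hypothesis
`h₂` = `RestrictionConfig.ext_of_avoid`) and the existence of `Φ_A`, `Φ'_A(0)` (hypotheses
`hΦ` = `IsStarHull.existsUnique_isRestrictionMap`, `hd` = `IsStarHull.exists_hasRestrictionDeriv`).
[cite: LawlerSchrammWerner2003Restriction, Prop. 3.3 (pp. 10–11)] -/
theorem IsRestrictionMeasure.unique (h₂ : RestrictionConfig.ext_of_avoid)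
    (hΦ : IsStarHull.existsUnique_isRestrictionMap) (hd : IsStarHull.exists_hasRestrictionDeriv)
    {α : ℝ} {P P' : Measure RestrictionConfig} (h : IsRestrictionMeasure α P)
    (h' : IsRestrictionMeasure α P') : P = P' := by
  refine h₂ P P' h.1 h'.1 fun A hA ↦ ?_
  obtain ⟨Φ, hΦA, -⟩ := hΦ hA
  obtain ⟨d, -, -, hdA⟩ := hd hA hΦA
  rw [h.2 hA hΦA hdA, h'.2 hA hΦA hdA]

/-- NAMED FACT — **[LSW] Proposition 3.3, (1) ⇒ (3)** (pp. 10–11): a probability measure on `Ω`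
which is `Γ`-invariant and `𝒜₁`-covariant — here in the homomorphism form
`RestrictionConfig.IsScaleInvariant`, `RestrictionConfig.IsHullMultiplicative` in which the proof
(pp. 11–13: `F(G_t) = e^{-2αt} = G_t'(0)^α` along the Loewner semigroup `G_t`, scale invariance
`F(G_t^λ) = F(G_t)`, Lemma 3.5, `α₋ = α`) uses hypothesis (1) — satisfies
`P[K ∩ A = ∅] = Φ'_A(0)^α` for all `A ∈ 𝒬*`, for some `α > 0`; i.e. `P = P_α`.
[cite: LawlerSchrammWerner2003Restriction, Prop. 3.3 (1) ⇒ (3) (pp. 10–13)] -/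
def exists_isRestrictionMeasure_of_isHullMultiplicative : Prop :=
  ∀ P : Measure RestrictionConfig, IsProbabilityMeasure P →
    RestrictionConfig.IsScaleInvariant P → RestrictionConfig.IsHullMultiplicative P →
      ∃ α : ℝ, 0 < α ∧ IsRestrictionMeasure α P

/-- NAMED FACT — **[LSW] p. 5, result 1** ("The restriction measure `P_α` exists if and only if
`α ≥ 5/8`", `α` "a positive number", p. 4): existence for `α ≥ 5/8` is Thm. 6.1 (`α = 5/8`,
SLE_{8/3}) and Thm. 7.3 (p. 29, SLE_κ plus Brownian bubbles; §4 for `α = 1`); non-existence for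
`α < 5/8` is Cor. 8.6 (p. 37).
[cite: LawlerSchrammWerner2003Restriction, p. 5 result 1; Thm. 7.3 (p. 29), Cor. 8.6 (p. 37)] -/
def exists_isRestrictionMeasure_iff : Prop :=
  ∀ α : ℝ, 0 < α → ((∃ P, IsRestrictionMeasure α P) ↔ 5 / 8 ≤ α)

/-- NAMED FACT — **[LSW] p. 5, result 2, first sentence** ("The only measure `P_α` that is
supported on simple curves is `P_{5/8}`"): if `P_α`-almost every configuration is a simple curve
from `0` to `∞` (`∀ᵐ`, i.e. the non-simple configurations are contained in a `P_α`-null event —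
the reading used by `Literature.Probability.RandomPlanarGeometry.LawlerSchrammWerner2003`), then `α = 5/8`. (For `α > 5/8`, `P_α` is the
law of SLE_κ, `κ < 8/3`, decorated with a Poisson cloud of filled Brownian bubbles of positive
intensity, Thm. 7.3, so `P_α` is carried by configurations with interior points, none of which is
a simple curve; `α < 5/8` is excluded by Cor. 8.6; `P_{5/8}` itself is carried by simple curves by
Thm. 6.1 and [42] = Rohde–Schramm.) The second sentence, "It is the law of chordal SLE_{8/3}", is
Thm. 6.1 (`Literature.Probability.RandomPlanarGeometry.sle_restriction_eightThirds`).
[cite: LawlerSchrammWerner2003Restriction, p. 5 result 2; Thm. 7.3 (p. 29), Cor. 8.6 (p. 37)] -/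
def IsRestrictionMeasure.eq_five_eighths_of_simple : Prop :=
  ∀ {α : ℝ} {P : Measure RestrictionConfig}, IsRestrictionMeasure α P →
    (∀ᵐ K ∂P, K.IsSimplePath) → α = 5 / 8

/-- NAMED FACT — **[LSW] p. 5, result 2, first sentence, with "supported on simple curves" read
as a support (outer-measure) condition.** "The only measure `P_α` that is supported on simple
curves is `P_{5/8}`": if every MEASURABLE event of `Ω` containing all simple-curve
configurations is `P_α`-almost sure (i.e. the set of simple curves has outer `P_α`-measure `1`),
then `α = 5/8`. The σ-field of `Ω` is generated by the avoidance events ([LSW] §3 p. 10) and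
the set of simple curves is not asserted to be measurable for it, so "supported on" — the
(closed) support notion — is naturally an outer-measure statement; this reading is implied by,
and for pushed-forward laws is the usable form of, the `∀ᵐ` reading of
`IsRestrictionMeasure.eq_five_eighths_of_simple` (`eq_five_eighths_of_simple_of_outer`: the
present def implies that one). Mathematically the two readings have the same content: for
`α > 5/8`, `P_α` gives measure `1` to the measurable event "`K` has an interior point" (the
filled Brownian bubbles of Thm. 7.3, p. 29), which contains no simple curve; `α < 5/8` is
excluded by Cor. 8.6 (p. 37).
[cite: LawlerSchrammWerner2003Restriction, p. 5 result 2; Thm. 7.3 (p. 29), Cor. 8.6 (p. 37)] -/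
def IsRestrictionMeasure.eq_five_eighths_of_outer_simple : Prop :=
  ∀ {α : ℝ} {P : Measure RestrictionConfig}, IsRestrictionMeasure α P →
    (∀ S : Set RestrictionConfig, MeasurableSet S → {K | K.IsSimplePath} ⊆ S → P S = 1) → α = 5 / 8

/-- The outer-measure reading implies the almost-everywhere reading: if `P`-a.e. configuration
is a simple curve, every measurable event containing the simple curves is almost sure. [folklore] -/
theorem IsRestrictionMeasure.eq_five_eighths_of_simple_of_outer
    (h : IsRestrictionMeasure.eq_five_eighths_of_outer_simple) :
    IsRestrictionMeasure.eq_five_eighths_of_simple := by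
  intro α P hP hae
  haveI := hP.isProbabilityMeasure
  refine h hP fun S hS hsub ↦ ?_
  have h1 : ∀ᵐ K ∂P, K ∈ S := hae.mono fun K hK ↦ hsub hK
  rw [← measure_univ (μ := P)]
  refine measure_congr ?_
  filter_upwards [h1] with K hK
  exact propext ⟨fun _ ↦ trivial, fun _ ↦ hK⟩

end Literature.Probability.RandomPlanarGeometry

end
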